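import Summits.MatrixMultiplication.OmegaCensus.STPP222TetraSort

/-!
# ω-census, the pattern `(2,2,2)⁴`: normal form and the assembly theorem for a three-stage linear start cover

HONEST FRAMING (pub-omega census; verbatim): lottery ticket; floor = certified bounds/negative ranges.
Census STRUCTURE bookkeeping (question Q7, row `k = 4`: a KERNEL leg for the lower half `n₄ ≥ 56` on the cell `(ℤ/2)⁵`, whose
census engine legs need `GL₅(𝔽₂)`-sized symmetry handling — ENG2 cfind n4b, ENG1 c4x via a Borel subgroup), not progress on `ω`.

The normal form `exists_nf4` (per-triple translations + global `B`/`C` shifts, `STPP222SqNeg.isSTPP_translate`), the core contradiction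
`named_contra4`, the four start exclusions `start_ne` (Def. 5.1 with `i = j = k = 0`: `b ≠ a`, `c ∉ {a, b, a + b}`), and the ASSEMBLY THEOREM
`not_exists_of_cover4`: a kernel search over ONE target start `(t₁, t₂, t₃)` plus three lists of injective endomorphisms moving, in
turn, `a ↦ t₁`, `b ↦ t₂` (fixing `t₁`) and `c ↦ t₃` (fixing `t₁, t₂`) — for an elementary abelian `2`-group, the transitivity of `GL` on
independent triples — refute every `(2,2,2)⁴` family (tree `IsSTPP.image`).

References: H. Cohn, R. Kleinberg, B. Szegedy, C. Umans, FOCS 2005 (arXiv:math/0511460), Def. 5.1.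
Record: pub-omega HOME `pub-omega-eng2-g23/tetra/` (ENG2 gen 23, 2026-08-26): generators `k4gen.py` (clause lists; levels 0–12 are
literally the `(2,2,2)³` words), `search4.py` (Python mirror of this engine, node-for-node equal to the C census engine cfind v1.2
run WITHOUT symmetry flags on `(ℤ/2)⁵`: 48 024 nodes / 4 115 340 clause evaluations, INFEASIBLE), `gen5.py` (the `GL₅(𝔽₂)` cover maps).
-/

open Literature.Computability.AlgebraicComplexity Finset

namespace Summit.MatrixMultiplication.OmegaCensus

namespace STPP222TetraNeg

open STPP222SqNeg (qcovB exists_qs_of_qcovB isSTPP_translate)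

/-! ## 9. Normal form -/

/-- The assignment of the 18 unknowns read off chosen elements: differences for `A t`, `B 0`, `C 0`, translated
elements for `B t`, `C t` (`t = 1, 2, 3`). -/
def nfVal {G : Type} [AddCommGroup G]
    (x₀ x₁ y₀ y₁ z₀ z₁ w₀ w₁ m₀ m₁ n₀ n₁ k₀ k₁ j₀ j₁ o₀ o₁ p₀ p₁ l₀ l₁ i₀ i₁ : G) : V18 → G
  | .a0 => x₁ - x₀
  | .b0 => m₁ - m₀
  | .c0 => o₁ - o₀
  | .q1 => n₀ - (y₀ + (m₀ - x₀))
  | .r1 => p₀ - (y₀ + (o₀ - x₀))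
  | .q1' => n₁ - (y₀ + (m₀ - x₀))
  | .r1' => p₁ - (y₀ + (o₀ - x₀))
  | .a1 => y₁ - y₀
  | .q2 => k₀ - (z₀ + (m₀ - x₀))
  | .r2 => l₀ - (z₀ + (o₀ - x₀))
  | .q2' => k₁ - (z₀ + (m₀ - x₀))
  | .r2' => l₁ - (z₀ + (o₀ - x₀))
  | .a2 => z₁ - z₀
  | .q3 => j₀ - (w₀ + (m₀ - x₀))
  | .r3 => i₀ - (w₀ + (o₀ - x₀))
  | .q3' => j₁ - (w₀ + (m₀ - x₀))
  | .r3' => i₁ - (w₀ + (o₀ - x₀))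
  | .a3 => w₁ - w₀

/-- NORMAL FORM.  From an STPP family and two distinct chosen elements of each of its twelve sets (`x, y, z, w` in
`A 0..3`, `m, n, k, j` in `B 0..3`, `o, p, l, i` in `C 0..3`), the translated family (`isSTPP_translate` with
`g = (x₀, y₀, z₀, w₀)`, `β = m₀ − x₀`, `γ = o₀ − x₀`) is an STPP family in membership normal form for the assignment
`nfVal …`. [cite: CohnKleinbergSzegedyUmans2005, Def. 5.1] -/
theorem exists_nf4 {G : Type} [AddCommGroup G] [DecidableEq G] {A B C : Fin 4 → Finset G} (hS : IsSTPP A B C)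
    {x₀ x₁ y₀ y₁ z₀ z₁ w₀ w₁ m₀ m₁ n₀ n₁ k₀ k₁ j₀ j₁ o₀ o₁ p₀ p₁ l₀ l₁ i₀ i₁ : G}
    (hx₀ : x₀ ∈ A 0) (hx₁ : x₁ ∈ A 0) (hx : x₀ ≠ x₁) (hy₀ : y₀ ∈ A 1) (hy₁ : y₁ ∈ A 1) (hy : y₀ ≠ y₁)
    (hz₀ : z₀ ∈ A 2) (hz₁ : z₁ ∈ A 2) (hz : z₀ ≠ z₁) (hw₀ : w₀ ∈ A 3) (hw₁ : w₁ ∈ A 3) (hw : w₀ ≠ w₁)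
    (hm₀ : m₀ ∈ B 0) (hm₁ : m₁ ∈ B 0) (hm : m₀ ≠ m₁) (hn₀ : n₀ ∈ B 1) (hn₁ : n₁ ∈ B 1) (hn : n₀ ≠ n₁)
    (hk₀ : k₀ ∈ B 2) (hk₁ : k₁ ∈ B 2) (hk : k₀ ≠ k₁) (hj₀ : j₀ ∈ B 3) (hj₁ : j₁ ∈ B 3) (hj : j₀ ≠ j₁)
    (ho₀ : o₀ ∈ C 0) (ho₁ : o₁ ∈ C 0) (ho : o₀ ≠ o₁) (hp₀ : p₀ ∈ C 1) (hp₁ : p₁ ∈ C 1) (hp : p₀ ≠ p₁)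
    (hl₀ : l₀ ∈ C 2) (hl₁ : l₁ ∈ C 2) (hl : l₀ ≠ l₁) (hi₀ : i₀ ∈ C 3) (hi₁ : i₁ ∈ C 3) (hi : i₀ ≠ i₁) :
    ∃ A' B' C' : Fin 4 → Finset G, IsSTPP A' B' C' ∧
      NF A' B' C' (nfVal x₀ x₁ y₀ y₁ z₀ z₁ w₀ w₁ m₀ m₁ n₀ n₁ k₀ k₁ j₀ j₁ o₀ o₁ p₀ p₁ l₀ l₁ i₀ i₁) := by
  let g : Fin 4 → G := ![x₀, y₀, z₀, w₀]
  refine ⟨fun t => (A t).image (· - g t), fun t => (B t).image (· - (g t + (m₀ - x₀))),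
    fun t => (C t).image (· - (g t + (o₀ - x₀))), isSTPP_translate hS g _ _, ?_⟩
  constructor
  · intro t e
    cases t <;> cases e
    · exact Finset.mem_image.2 ⟨x₀, hx₀, by simp [g, gA, oval, slotA, fin4]⟩
    · exact Finset.mem_image.2 ⟨x₁, hx₁, by simp [g, gA, oval, slotA, nfVal, fin4]⟩
    · exact Finset.mem_image.2 ⟨y₀, hy₀, by simp [g, gA, oval, slotA, fin4]⟩
    · exact Finset.mem_image.2 ⟨y₁, hy₁, by simp [g, gA, oval, slotA, nfVal, fin4]⟩
    · exact Finset.mem_image.2 ⟨z₀, hz₀, by simp [g, gA, oval, slotA, fin4]⟩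
    · exact Finset.mem_image.2 ⟨z₁, hz₁, by simp [g, gA, oval, slotA, nfVal, fin4]⟩
    · exact Finset.mem_image.2 ⟨w₀, hw₀, by simp [g, gA, oval, slotA, fin4]⟩
    · exact Finset.mem_image.2 ⟨w₁, hw₁, by simp [g, gA, oval, slotA, nfVal, fin4]⟩
  · intro t e
    cases t <;> cases e
    · exact Finset.mem_image.2 ⟨m₀, hm₀, by simp [g, gB, oval, slotB, fin4]⟩
    · exact Finset.mem_image.2 ⟨m₁, hm₁, by simp [g, gB, oval, slotB, nfVal, fin4]⟩
    · exact Finset.mem_image.2 ⟨n₀, hn₀, by simp [g, gB, oval, slotB, nfVal, fin4]⟩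
    · exact Finset.mem_image.2 ⟨n₁, hn₁, by simp [g, gB, oval, slotB, nfVal, fin4]⟩
    · exact Finset.mem_image.2 ⟨k₀, hk₀, by simp [g, gB, oval, slotB, nfVal, fin4]⟩
    · exact Finset.mem_image.2 ⟨k₁, hk₁, by simp [g, gB, oval, slotB, nfVal, fin4]⟩
    · exact Finset.mem_image.2 ⟨j₀, hj₀, by simp [g, gB, oval, slotB, nfVal, fin4]⟩
    · exact Finset.mem_image.2 ⟨j₁, hj₁, by simp [g, gB, oval, slotB, nfVal, fin4]⟩
  · intro t e
    cases t <;> cases e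
    · exact Finset.mem_image.2 ⟨o₀, ho₀, by simp [g, gC, oval, slotC, fin4]⟩
    · exact Finset.mem_image.2 ⟨o₁, ho₁, by simp [g, gC, oval, slotC, nfVal, fin4]⟩
    · exact Finset.mem_image.2 ⟨p₀, hp₀, by simp [g, gC, oval, slotC, nfVal, fin4]⟩
    · exact Finset.mem_image.2 ⟨p₁, hp₁, by simp [g, gC, oval, slotC, nfVal, fin4]⟩
    · exact Finset.mem_image.2 ⟨l₀, hl₀, by simp [g, gC, oval, slotC, nfVal, fin4]⟩
    · exact Finset.mem_image.2 ⟨l₁, hl₁, by simp [g, gC, oval, slotC, nfVal, fin4]⟩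
    · exact Finset.mem_image.2 ⟨i₀, hi₀, by simp [g, gC, oval, slotC, nfVal, fin4]⟩
    · exact Finset.mem_image.2 ⟨i₁, hi₁, by simp [g, gC, oval, slotC, nfVal, fin4]⟩
  · intro t e₁ e₂ he
    cases t <;> cases e₁ <;> cases e₂ <;> simp only [gA, oval, slotA, nfVal] at he <;> first
      | rfl | exact absurd (sub_eq_zero.1 he.symm) (Ne.symm hx) | exact absurd (sub_eq_zero.1 he) (Ne.symm hx)
      | exact absurd (sub_eq_zero.1 he.symm) (Ne.symm hy) | exact absurd (sub_eq_zero.1 he) (Ne.symm hy)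
      | exact absurd (sub_eq_zero.1 he.symm) (Ne.symm hz) | exact absurd (sub_eq_zero.1 he) (Ne.symm hz)
      | exact absurd (sub_eq_zero.1 he.symm) (Ne.symm hw) | exact absurd (sub_eq_zero.1 he) (Ne.symm hw)
  · intro t e₁ e₂ he
    cases t <;> cases e₁ <;> cases e₂ <;> simp only [gB, oval, slotB, nfVal] at he <;> first
      | rfl | exact absurd (sub_eq_zero.1 he.symm) (Ne.symm hm) | exact absurd (sub_eq_zero.1 he) (Ne.symm hm)
      | exact absurd (sub_left_injective he) hn | exact absurd (sub_left_injective he).symm hn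
      | exact absurd (sub_left_injective he) hk | exact absurd (sub_left_injective he).symm hk
      | exact absurd (sub_left_injective he) hj | exact absurd (sub_left_injective he).symm hj
  · intro t e₁ e₂ he
    cases t <;> cases e₁ <;> cases e₂ <;> simp only [gC, oval, slotC, nfVal] at he <;> first
      | rfl | exact absurd (sub_eq_zero.1 he.symm) (Ne.symm ho) | exact absurd (sub_eq_zero.1 he) (Ne.symm ho)
      | exact absurd (sub_left_injective he) hp | exact absurd (sub_left_injective he).symm hp
      | exact absurd (sub_left_injective he) hl | exact absurd (sub_left_injective he).symm hl
      | exact absurd (sub_left_injective he) hi | exact absurd (sub_left_injective he).symm hi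

/-- CORE CONTRADICTION.  An STPP family with two named elements in each of its twelve sets, whose oriented difference
triple `(x₁ - x₀, m₁ - m₀, o₁ - o₀)`, encoded, is a start triple of a start list that passed the kernel search and
the `q₁`-coverage check, cannot exist. [cite: CohnKleinbergSzegedyUmans2005, Def. 5.1] -/
theorem named_contra4 {G : Type} [AddCommGroup G] [DecidableEq G] (E : EncH G) {el : List ℕ}
    (hel : ∀ g : G, E.enc g ∈ el) {reps : List (ℕ × ℕ × ℕ × List ℕ)} (hs : searchB4 E.A el reps = true)
    (hq : qcovB el reps = true) {A B C : Fin 4 → Finset G} (hS : IsSTPP A B C)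
    {x₀ x₁ y₀ y₁ z₀ z₁ w₀ w₁ m₀ m₁ n₀ n₁ k₀ k₁ j₀ j₁ o₀ o₁ p₀ p₁ l₀ l₁ i₀ i₁ : G}
    (hx₀ : x₀ ∈ A 0) (hx₁ : x₁ ∈ A 0) (hx : x₀ ≠ x₁) (hy₀ : y₀ ∈ A 1) (hy₁ : y₁ ∈ A 1) (hy : y₀ ≠ y₁)
    (hz₀ : z₀ ∈ A 2) (hz₁ : z₁ ∈ A 2) (hz : z₀ ≠ z₁) (hw₀ : w₀ ∈ A 3) (hw₁ : w₁ ∈ A 3) (hw : w₀ ≠ w₁)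
    (hm₀ : m₀ ∈ B 0) (hm₁ : m₁ ∈ B 0) (hm : m₀ ≠ m₁) (hn₀ : n₀ ∈ B 1) (hn₁ : n₁ ∈ B 1) (hn : n₀ ≠ n₁)
    (hk₀ : k₀ ∈ B 2) (hk₁ : k₁ ∈ B 2) (hk : k₀ ≠ k₁) (hj₀ : j₀ ∈ B 3) (hj₁ : j₁ ∈ B 3) (hj : j₀ ≠ j₁)
    (ho₀ : o₀ ∈ C 0) (ho₁ : o₁ ∈ C 0) (ho : o₀ ≠ o₁) (hp₀ : p₀ ∈ C 1) (hp₁ : p₁ ∈ C 1) (hp : p₀ ≠ p₁)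
    (hl₀ : l₀ ∈ C 2) (hl₁ : l₁ ∈ C 2) (hl : l₀ ≠ l₁) (hi₀ : i₀ ∈ C 3) (hi₁ : i₁ ∈ C 3) (hi : i₀ ≠ i₁)
    (hrep : ∃ qs, (E.enc (x₁ - x₀), E.enc (m₁ - m₀), E.enc (o₁ - o₀), qs) ∈ reps) : False := by
  -- with the six translated pairs oriented by code, the normal form satisfies `HypsNoLex`
  have key : ∀ {n₀ n₁ k₀ k₁ j₀ j₁ p₀ p₁ l₀ l₁ i₀ i₁ : G}, n₀ ∈ B 1 → n₁ ∈ B 1 → n₀ ≠ n₁ → k₀ ∈ B 2 → k₁ ∈ B 2 →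
      k₀ ≠ k₁ → j₀ ∈ B 3 → j₁ ∈ B 3 → j₀ ≠ j₁ → p₀ ∈ C 1 → p₁ ∈ C 1 → p₀ ≠ p₁ → l₀ ∈ C 2 → l₁ ∈ C 2 → l₀ ≠ l₁ →
      i₀ ∈ C 3 → i₁ ∈ C 3 → i₀ ≠ i₁ →
      E.enc (n₀ - (y₀ + (m₀ - x₀))) < E.enc (n₁ - (y₀ + (m₀ - x₀))) →
      E.enc (p₀ - (y₀ + (o₀ - x₀))) < E.enc (p₁ - (y₀ + (o₀ - x₀))) →
      E.enc (k₀ - (z₀ + (m₀ - x₀))) < E.enc (k₁ - (z₀ + (m₀ - x₀))) →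
      E.enc (l₀ - (z₀ + (o₀ - x₀))) < E.enc (l₁ - (z₀ + (o₀ - x₀))) →
      E.enc (j₀ - (w₀ + (m₀ - x₀))) < E.enc (j₁ - (w₀ + (m₀ - x₀))) →
      E.enc (i₀ - (w₀ + (o₀ - x₀))) < E.enc (i₁ - (w₀ + (o₀ - x₀))) → False := by
    intro n₀ n₁ k₀ k₁ j₀ j₁ p₀ p₁ l₀ l₁ i₀ i₁ hn₀ hn₁ hn hk₀ hk₁ hk hj₀ hj₁ hj hp₀ hp₁ hp hl₀ hl₁ hl hi₀ hi₁ hi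
      h1 h2 h3 h4 h5 h6
    obtain ⟨A', B', C', hS', hN'⟩ := exists_nf4 hS hx₀ hx₁ hx hy₀ hy₁ hy hz₀ hz₁ hz hw₀ hw₁ hw hm₀ hm₁ hm hn₀ hn₁ hn
      hk₀ hk₁ hk hj₀ hj₁ hj ho₀ ho₁ ho hp₀ hp₁ hp hl₀ hl₁ hl hi₀ hi₁ hi
    obtain ⟨qs, hqs⟩ := hrep
    exact nf_contra4 E hel hs hq hS' hN'
      ⟨sub_ne_zero.2 (Ne.symm hx), sub_ne_zero.2 (Ne.symm hy), sub_ne_zero.2 (Ne.symm hz), sub_ne_zero.2 (Ne.symm hw),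
        sub_ne_zero.2 (Ne.symm hm), sub_ne_zero.2 (Ne.symm ho), h1, h2, h3, h4, h5, h6⟩ hqs
  -- choose orientations of the six pairs by code order of the translated elements
  have tr : ∀ (w : G) {S : Finset G} {u v : G}, u ∈ S → v ∈ S → u ≠ v →
      ∃ a b : G, a ∈ S ∧ b ∈ S ∧ a ≠ b ∧ E.enc (a - w) < E.enc (b - w) := by
    intro w S u v hu hv huv
    have hne : E.enc (u - w) ≠ E.enc (v - w) := fun e => huv (sub_left_injective (E.enc_inj e))
    rcases Nat.lt_or_gt_of_ne hne with h | h
    · exact ⟨u, v, hu, hv, huv, h⟩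
    · exact ⟨v, u, hv, hu, huv.symm, h⟩
  obtain ⟨n₀', n₁', hn₀', hn₁', hn', h1⟩ := tr (y₀ + (m₀ - x₀)) hn₀ hn₁ hn
  obtain ⟨p₀', p₁', hp₀', hp₁', hp', h2⟩ := tr (y₀ + (o₀ - x₀)) hp₀ hp₁ hp
  obtain ⟨k₀', k₁', hk₀', hk₁', hk', h3⟩ := tr (z₀ + (m₀ - x₀)) hk₀ hk₁ hk
  obtain ⟨l₀', l₁', hl₀', hl₁', hl', h4⟩ := tr (z₀ + (o₀ - x₀)) hl₀ hl₁ hl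
  obtain ⟨j₀', j₁', hj₀', hj₁', hj', h5⟩ := tr (w₀ + (m₀ - x₀)) hj₀ hj₁ hj
  obtain ⟨i₀', i₁', hi₀', hi₁', hi', h6⟩ := tr (w₀ + (o₀ - x₀)) hi₀ hi₁ hi
  exact key hn₀' hn₁' hn' hk₀' hk₁' hk' hj₀' hj₁' hj' hp₀' hp₁' hp' hl₀' hl₁' hl' hi₀' hi₁' hi' h1 h2 h3 h4 h5 h6

/-! ## 10. The start of an STPP family: four linear exclusions (Def. 5.1 with `i = j = k = 0`) -/

/-- In an STPP family, the differences `a = x₁ − x₀`, `b = m₁ − m₀`, `c = o₁ − o₀` of distinct element pairs of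
`A 0`, `B 0`, `C 0` satisfy `b ≠ a`, `c ≠ a`, `c ≠ b`, `c ≠ a + b`. [cite: CohnKleinbergSzegedyUmans2005, Def. 5.1] -/
theorem start_ne {G : Type} [AddCommGroup G] {N : ℕ} {A B C : Fin (N + 1) → Finset G} (hS : IsSTPP A B C)
    {x₀ x₁ m₀ m₁ o₀ o₁ : G} (hx₀ : x₀ ∈ A 0) (hx₁ : x₁ ∈ A 0) (hx : x₀ ≠ x₁) (hm₀ : m₀ ∈ B 0) (hm₁ : m₁ ∈ B 0)
    (hm : m₀ ≠ m₁) (ho₀ : o₀ ∈ C 0) (ho₁ : o₁ ∈ C 0) :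
    m₁ - m₀ ≠ x₁ - x₀ ∧ o₁ - o₀ ≠ x₁ - x₀ ∧ o₁ - o₀ ≠ m₁ - m₀ ∧ o₁ - o₀ ≠ (x₁ - x₀) + (m₁ - m₀) := by
  refine ⟨fun h => ?_, fun h => ?_, fun h => ?_, fun h => ?_⟩
  · have := (hS 0 0 0 x₀ hx₀ x₁ hx₁ m₁ hm₁ m₀ hm₀ o₀ ho₀ o₀ ho₀
      (by rw [sub_self, add_zero, ← h, sub_add_sub_cancel, sub_self])).2.2.1
    exact hx this
  · have := (hS 0 0 0 x₀ hx₀ x₁ hx₁ m₀ hm₀ m₀ hm₀ o₁ ho₁ o₀ ho₀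
      (by rw [show x₁ - x₀ = o₁ - o₀ from h.symm]; abel)).2.2.1
    exact hx this
  · have := (hS 0 0 0 x₀ hx₀ x₀ hx₀ m₀ hm₀ m₁ hm₁ o₁ ho₁ o₀ ho₀
      (by rw [show m₁ - m₀ = o₁ - o₀ from h.symm]; abel)).2.2.2.1
    exact hm this
  · have := (hS 0 0 0 x₀ hx₀ x₁ hx₁ m₀ hm₀ m₁ hm₁ o₁ ho₁ o₀ ho₀
      (by rw [← h]; abel)).2.2.1
    exact hx this

/-! ## 11. The assembly theorem for a three-stage linear cover of the starts -/

/-- ASSEMBLY THEOREM (three-stage start cover).  Data: a homomorphic encoding `E`, the code list `el` of all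
elements, a start list `reps` whose kernel search succeeded and which passes the `q₁`-coverage check and contains
the TARGET start `(t₁, t₂, t₃)`; the element list `elG`; three lists of injective endomorphisms with the COVERING
facts: `F₁` moves every nonzero element to `t₁`; `F₂` fixes `t₁` and moves every other nonzero element to `t₂`;
`F₃` fixes `t₁, t₂` and moves every element outside `{0, t₁, t₂, t₁ + t₂}` to `t₃` (for an elementary abelian
`2`-group: `GL` is transitive on independent triples).  Conclusion: `G` admits no four simultaneous-TPP triples of
2-subsets. [cite: CohnKleinbergSzegedyUmans2005, Def. 5.1] -/
theorem not_exists_of_cover4 {G : Type} [AddCommGroup G] [DecidableEq G] (E : EncH G) (el : List ℕ)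
    (hel : ∀ g : G, E.enc g ∈ el) (reps : List (ℕ × ℕ × ℕ × List ℕ)) (hs : searchB4 E.A el reps = true)
    (hq : qcovB el reps = true) (t₁ t₂ t₃ : G) (hrep : ∃ qs, (E.enc t₁, E.enc t₂, E.enc t₃, qs) ∈ reps)
    (elG : List G) (helG : ∀ x : G, x ∈ elG) (F₁ F₂ F₃ : List (G →+ G))
    (hinj : ∀ f ∈ F₁ ++ F₂ ++ F₃, Function.Injective f) (hC1 : ∀ d ∈ elG, d ≠ 0 → ∃ f ∈ F₁, f d = t₁)
    (hC2 : ∀ d ∈ elG, d ≠ 0 → d ≠ t₁ → ∃ f ∈ F₂, f t₁ = t₁ ∧ f d = t₂)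
    (hC3 : ∀ d ∈ elG, d ≠ 0 → d ≠ t₁ → d ≠ t₂ → d ≠ t₁ + t₂ → ∃ f ∈ F₃, f t₁ = t₁ ∧ f t₂ = t₂ ∧ f d = t₃) :
    ¬ ∃ A B C : Fin 4 → Finset G, IsSTPP A B C ∧ ∀ i, (A i).card = 2 ∧ (B i).card = 2 ∧ (C i).card = 2 := by
  rintro ⟨A, B, C, hS, hcard⟩
  -- named elements
  obtain ⟨x₀, x₁, hx, hA0⟩ := Finset.card_eq_two.1 (hcard 0).1
  obtain ⟨y₀, y₁, hy, hA1⟩ := Finset.card_eq_two.1 (hcard 1).1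
  obtain ⟨z₀, z₁, hz, hA2⟩ := Finset.card_eq_two.1 (hcard 2).1
  obtain ⟨w₀, w₁, hw, hA3⟩ := Finset.card_eq_two.1 (hcard 3).1
  obtain ⟨m₀, m₁, hm, hB0⟩ := Finset.card_eq_two.1 (hcard 0).2.1
  obtain ⟨n₀, n₁, hn, hB1⟩ := Finset.card_eq_two.1 (hcard 1).2.1
  obtain ⟨k₀, k₁, hk, hB2⟩ := Finset.card_eq_two.1 (hcard 2).2.1
  obtain ⟨j₀, j₁, hj, hB3⟩ := Finset.card_eq_two.1 (hcard 3).2.1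
  obtain ⟨o₀, o₁, ho, hC0⟩ := Finset.card_eq_two.1 (hcard 0).2.2
  obtain ⟨p₀, p₁, hp, hC1'⟩ := Finset.card_eq_two.1 (hcard 1).2.2
  obtain ⟨l₀, l₁, hl, hC2'⟩ := Finset.card_eq_two.1 (hcard 2).2.2
  obtain ⟨i₀, i₁, hi, hC3'⟩ := Finset.card_eq_two.1 (hcard 3).2.2
  have M : ∀ {S : Finset G} {u v : G}, S = {u, v} → u ∈ S ∧ v ∈ S := fun h => by subst h; simp
  -- a generic step: push a family with named elements through an injective endomorphism
  have IM : ∀ (f : G →+ G), Function.Injective f → ∀ {S : Finset G} {u : G}, u ∈ S → f u ∈ S.image f :=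
    fun f _ S u h => mem_image_of_mem f h
  have DI : ∀ (f : G →+ G), Function.Injective f → ∀ {u v : G}, u ≠ v → f u ≠ f v := fun f hf u v h e => h (hf e)
  -- stage 1: move `x₁ - x₀` to `t₁`
  obtain ⟨f, hf, hft⟩ := hC1 (x₁ - x₀) (helG _) (sub_ne_zero.2 (Ne.symm hx))
  have hfi : Function.Injective f := hinj f (by simp [hf])
  set A₁ : Fin 4 → Finset G := fun t => (A t).image f with hA₁
  set B₁ : Fin 4 → Finset G := fun t => (B t).image f with hB₁
  set C₁ : Fin 4 → Finset G := fun t => (C t).image f with hC₁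
  have hS₁ : IsSTPP A₁ B₁ C₁ := hS.image f hfi
  have ha₁ : f x₁ - f x₀ = t₁ := by rw [← map_sub, hft]
  -- stage 2: move the `B 0`-difference to `t₂`, fixing `t₁`
  obtain ⟨hne1, -, -, -⟩ := start_ne hS₁ (IM f hfi (M hA0).1) (IM f hfi (M hA0).2) (DI f hfi hx)
    (IM f hfi (M hB0).1) (IM f hfi (M hB0).2) (DI f hfi hm) (IM f hfi (M hC0).1) (IM f hfi (M hC0).2)
  rw [ha₁] at hne1
  obtain ⟨g, hg, hgt₁, hgt⟩ := hC2 (f m₁ - f m₀) (helG _) (sub_ne_zero.2 (DI f hfi hm).symm) hne1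
  have hgi : Function.Injective g := hinj g (by simp [hg])
  set A₂ : Fin 4 → Finset G := fun t => (A₁ t).image g with hA₂
  set B₂ : Fin 4 → Finset G := fun t => (B₁ t).image g with hB₂
  set C₂ : Fin 4 → Finset G := fun t => (C₁ t).image g with hC₂
  have hS₂ : IsSTPP A₂ B₂ C₂ := hS₁.image g hgi
  have ha₂ : g (f x₁) - g (f x₀) = t₁ := by rw [← map_sub, ha₁, hgt₁]
  have hb₂ : g (f m₁) - g (f m₀) = t₂ := by rw [← map_sub, hgt]
  -- stage 3: move the `C 0`-difference to `t₃`, fixing `t₁, t₂`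
  have I2 : ∀ {S : Finset G} {u : G}, u ∈ S → g (f u) ∈ (S.image f).image g :=
    fun h => IM g hgi (IM f hfi h)
  have D2 : ∀ {u v : G}, u ≠ v → g (f u) ≠ g (f v) := fun h => DI g hgi (DI f hfi h)
  obtain ⟨-, hne2, hne3, hne4⟩ := start_ne hS₂ (I2 (M hA0).1) (I2 (M hA0).2) (D2 hx) (I2 (M hB0).1)
    (I2 (M hB0).2) (D2 hm) (I2 (M hC0).1) (I2 (M hC0).2)
  rw [ha₂] at hne2 hne4
  rw [hb₂] at hne3 hne4
  obtain ⟨h, hh, hht₁, hht₂, hht⟩ := hC3 (g (f o₁) - g (f o₀)) (helG _) (sub_ne_zero.2 (D2 ho).symm) hne2 hne3 hne4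
  have hhi : Function.Injective h := hinj h (by simp [hh])
  have hS₃ : IsSTPP (fun t => (A₂ t).image h) (fun t => (B₂ t).image h) (fun t => (C₂ t).image h) :=
    hS₂.image h hhi
  have I3 : ∀ {S : Finset G} {u : G}, u ∈ S → h (g (f u)) ∈ ((S.image f).image g).image h :=
    fun hu => IM h hhi (I2 hu)
  have D3 : ∀ {u v : G}, u ≠ v → h (g (f u)) ≠ h (g (f v)) := fun huv => DI h hhi (D2 huv)
  refine named_contra4 E hel hs hq hS₃ (I3 (M hA0).1) (I3 (M hA0).2) (D3 hx) (I3 (M hA1).1) (I3 (M hA1).2)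
    (D3 hy) (I3 (M hA2).1) (I3 (M hA2).2) (D3 hz) (I3 (M hA3).1) (I3 (M hA3).2) (D3 hw) (I3 (M hB0).1)
    (I3 (M hB0).2) (D3 hm) (I3 (M hB1).1) (I3 (M hB1).2) (D3 hn) (I3 (M hB2).1) (I3 (M hB2).2) (D3 hk)
    (I3 (M hB3).1) (I3 (M hB3).2) (D3 hj) (I3 (M hC0).1) (I3 (M hC0).2) (D3 ho) (I3 (M hC1').1)
    (I3 (M hC1').2) (D3 hp) (I3 (M hC2').1) (I3 (M hC2').2) (D3 hl) (I3 (M hC3').1) (I3 (M hC3').2) (D3 hi) ?_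
  rw [← map_sub, ha₂, hht₁, ← map_sub, hb₂, hht₂, ← map_sub, hht]
  exact hrep

end STPP222TetraNeg

end Summit.MatrixMultiplication.OmegaCensus
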